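import Mathlib

/-!
# Mellin-side Plancherel for generalised Dirichlet polynomials (line `SketchIdeator5`)

Stub `stub_plancherel` of the crux `FanDecorrelation`
(`Summit.Parity.GeneralizedHardyLittlewood.Theses.LiouvilleMAD`), line `SketchIdeator5`
(idea `mellin-height-law`): the card's first lemma `MellinPlancherel`.

For an integrable kernel `K : ℝ → ℂ`, finitely many real frequencies `ω_y = freq y` (`y ∈ s`)
and coefficients `a, b : ℕ → ℂ`, writing `X_a(t) = Σ_{y ∈ s} a_y e^{−itω_y}`,
`∫ K(t) X_a(t) conj(X_b(t)) dt = Σ_{y,y' ∈ s} a_y conj(b_{y'}) ∫ K(t) e^{−it(ω_y − ω_{y'})} dt`.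

Proof: expand the product of the two finite sums, push `conj` through (`conj e^{−itω} = e^{itω}`),
combine the exponentials, and interchange the finite double sum with the integral
(`MeasureTheory.integral_finsetSum`); each term `K(t) e^{−itu}` is integrable because the phase
has modulus `1` (`MeasureTheory.Integrable.mul_bdd`).

Design: a `Theorems` support file declares no definitions; everything is written out over Mathlib.
-/

namespace Summit.Parity.GeneralizedHardyLittlewood.Theorems.FanDecorrelation.Plancherel

open MeasureTheory

/-- The phase `t ↦ K(t) e^{−itu}` of an integrable kernel is integrable (`|e^{−itu}| = 1`).
[folklore] -/
theorem integrable_mul_phase {K : ℝ → ℂ} (hK : Integrable K) (u : ℝ) :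
    Integrable (fun t : ℝ => K t * Complex.exp (-(((t * u : ℝ) : ℂ) * Complex.I))) := by
  refine hK.mul_bdd (c := 1) (Continuous.aestronglyMeasurable (by fun_prop)) ?_
  filter_upwards with t
  have h : -(((t * u : ℝ) : ℂ) * Complex.I) = ((-(t * u) : ℝ) : ℂ) * Complex.I := by
    push_cast; ring
  rw [h, Complex.norm_exp_ofReal_mul_I]

/-- Pointwise expansion of the integrand: `K X_a conj(X_b)` is the double sum
`Σ_{y,y'} a_y conj(b_{y'}) · (K(t) e^{−it(ω_y − ω_{y'})})`. [folklore] -/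
theorem integrand_eq (s : Finset ℕ) (freq : ℕ → ℝ) (a b : ℕ → ℂ) (K : ℝ → ℂ) (t : ℝ) :
    K t * (∑ y ∈ s, a y * Complex.exp (-(((t * freq y : ℝ) : ℂ) * Complex.I))) *
        (starRingEnd ℂ) (∑ y ∈ s, b y * Complex.exp (-(((t * freq y : ℝ) : ℂ) * Complex.I))) =
      ∑ y ∈ s, ∑ y' ∈ s, a y * (starRingEnd ℂ) (b y') *
        (K t * Complex.exp (-(((t * (freq y - freq y') : ℝ) : ℂ) * Complex.I))) := by
  rw [map_sum, mul_assoc, Finset.sum_mul_sum, Finset.mul_sum]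
  refine Finset.sum_congr rfl fun y _ => ?_
  rw [Finset.mul_sum]
  refine Finset.sum_congr rfl fun y' _ => ?_
  rw [map_mul, ← Complex.exp_conj, map_neg, map_mul, Complex.conj_ofReal, Complex.conj_I]
  have h : Complex.exp (-(((t * (freq y - freq y') : ℝ) : ℂ) * Complex.I)) =
      Complex.exp (-(((t * freq y : ℝ) : ℂ) * Complex.I)) *
        Complex.exp (-(((t * freq y' : ℝ) : ℂ) * -Complex.I)) := by
    rw [← Complex.exp_add]
    congr 1
    push_cast
    ring
  rw [h]
  ring

/-- **Mellin-side Plancherel for generalised Dirichlet polynomials** (stub `stub_plancherel` of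
line `SketchIdeator5`): for an integrable kernel `K`, finitely many real frequencies `ω_y` and
coefficients `a, b`,
`∫ K(t)·(Σ_y a_y e^{−itω_y})·conj(Σ_{y'} b_{y'} e^{−itω_{y'}}) dt
   = Σ_{y,y'} a_y conj(b_{y'}) ∫ K(t) e^{−it(ω_y − ω_{y'})} dt`. [folklore] -/
theorem stub_plancherel :
    ∀ (s : Finset ℕ) (freq : ℕ → ℝ) (a b : ℕ → ℂ) (K : ℝ → ℂ), Integrable K →
      ∫ t : ℝ, K t * (∑ y ∈ s, a y * Complex.exp (-(((t * freq y : ℝ) : ℂ) * Complex.I))) *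
          (starRingEnd ℂ) (∑ y ∈ s, b y * Complex.exp (-(((t * freq y : ℝ) : ℂ) * Complex.I))) =
        ∑ y ∈ s, ∑ y' ∈ s, a y * (starRingEnd ℂ) (b y') *
          ∫ t : ℝ, K t * Complex.exp (-(((t * (freq y - freq y') : ℝ) : ℂ) * Complex.I)) := by
  intro s freq a b K hK
  simp_rw [integrand_eq]
  have hterm : ∀ y y' : ℕ, Integrable (fun t : ℝ => a y * (starRingEnd ℂ) (b y') *
      (K t * Complex.exp (-(((t * (freq y - freq y') : ℝ) : ℂ) * Complex.I)))) :=
    fun y y' => (integrable_mul_phase hK _).const_mul _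
  rw [integral_finsetSum s fun y _ => integrable_finsetSum s fun y' _ => hterm y y']
  refine Finset.sum_congr rfl fun y _ => ?_
  rw [integral_finsetSum s fun y' _ => hterm y y']
  refine Finset.sum_congr rfl fun y' _ => ?_
  exact integral_const_mul _ _

end Summit.Parity.GeneralizedHardyLittlewood.Theorems.FanDecorrelation.Plancherel
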